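import Summits.AtomisticToContinuum.BoseEinsteinCondensation.Theorems.BECGroundStateSOSPeriodicIRBoundTwoSectorDefs
import Summits.AtomisticToContinuum.BoseEinsteinCondensation.Theorems.BECGroundStateSOSPeriodicIRBoundTwoSectorKato
import Summits.AtomisticToContinuum.BoseEinsteinCondensation.Theorems.BECGroundStateSOSPeriodicIRBoundTwoSectorKLS
import Summits.AtomisticToContinuum.BoseEinsteinCondensation.Theorems.BECGroundStateSOSPeriodicIRBoundTransferArith
import Summits.AtomisticToContinuum.BoseEinsteinCondensation.Theorems.BECGroundStateSOSPeriodicIRBoundWFKinematics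
import Summits.AtomisticToContinuum.BoseEinsteinCondensation.Theorems.BECGroundStateSOSPeriodicIRBoundWFVariational
import Summits.AtomisticToContinuum.BoseEinsteinCondensation.Theorems.BECFeynmanVortexAreaZeroMomentumGround
import Summits.AtomisticToContinuum.BoseEinsteinCondensation.Theorems.BECInsertionCorrectorCorrectorClosureChemicalPotentialBorn
import Literature.MathematicalPhysics.QuantumManyBody.PeriodicBoseGasImpurityTranslation
import HarnessLib

/-!
# Route `BECTwoSectorGD`, support item `KLSTransfer` (stmt-AtomisticToContinuum-12622) from the stubs S3–S4 of the crux line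
# `two-sector-gd-transfer` of `PeriodicIRBound` (stmt-AtomisticToContinuum-3972) — one proof, two routes

`BECTwoSectorGD.KLSTransfer` (stmt-12622): for an integrable admissible `v`, the two-sector Gaussian-domination body (`GDFor v K ρ₀ C`
for some `K, ρ₀, C > 0`, = the body of stmt-12620) implies the periodic infrared-bound body with the Kennedy–Lieb–Shastry shape
`n_Ψ(n) ≤ C'(1 + √ρL_N/‖n‖ + ρL_N²/‖n‖²)` for `δ`-near-minimisers along `L_N = (N/ρ)^{1/3}`, `0 < 2π‖n‖/L_N ≤ K`.

Proof = the BORN variant of the line's window assembly: the Kato step `KatoSusceptibility` (stub S3) turns GD into the regularised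
two-channel susceptibility bounds `b_± ≤ b = CL²/‖n‖²` at the pairs `(N, N+1)` and `(N−1, N)`; the KLS Cauchy–Schwarz at a
near-minimiser `KLSNearMinimiser` (stub S4, landed) gives at fixed `(N, L_N)`
`y² ≤ 2b[(1+η)(|2πn/L|² + 2N‖v‖₁/L³ + E₀(N)y − E₀(N−1)n_k − E₀(N+1)(n_k+1)) + η(y+1)]`, `y = 2n_k+1`; monotonicity
`E₀(N) ≤ E₀(N+1)` (`WF.periodicGroundStateEnergy_le_succ`) and the Born bound on the chemical potential
`E₀(N) ≤ E₀(N−1) + (N−1)‖v‖₁/L³ ≤ E₀(N−1) + ρ‖v‖₁` (`periodicGroundStateEnergy_succ_le_add_born`) bound the `E₀`-combination by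
`n_k·ρ‖v‖₁` — which produces the `ρL²/‖n‖²` term of the exponent-2 shape (no convexity needed); the scalar endgame `kls_endgame`
with `η_n = min(1, ‖n‖²/(CL²))` and the least slack over the finite box of modes `‖n‖ ≤ KL/(2π)` finish. Constants:
`C' = 2 + √(12π²C+1) + √(2C‖v‖₁) + C‖v‖₁`. References (shape only; nothing cited as a fact): Kennedy–Lieb–Shastry, J. Stat. Phys.
53 (1988) 1019, (12)–(14); Dyson–Lieb–Simon, J. Stat. Phys. 18 (1978) 335, §1.
-/

noncomputable section

open scoped BigOperators ENNReal ComplexConjugate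
open Filter MeasureTheory

namespace Summit.AtomisticToContinuum.BoseEinsteinCondensation.Cruxes.PeriodicIRBound.TwoSectorGdTransfer

open Literature.MathematicalPhysics.QuantumManyBody.BoseGas
open Summit.AtomisticToContinuum.BoseEinsteinCondensation.Theses.BECTwoSectorGD (KLSTransfer)
open Summit.AtomisticToContinuum.BoseEinsteinCondensation.Cruxes.PeriodicIRBound.LinearPhFloorWagner
  (TransferArith.norm_latticeVec_eq)
open Summit.AtomisticToContinuum.BoseEinsteinCondensation.Cruxes.PeriodicIRBound.LinearPhFloorWagner.WF
  (periodicGroundStateEnergy_le_succ cellOccupation_le_mul_normSq normSq)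
open Summit.AtomisticToContinuum.BoseEinsteinCondensation.Theorems.GaussianDominationCan.Negative (nsq one_le_norm_intVec)
open Summit.AtomisticToContinuum.BoseEinsteinCondensation.Theorems.PeriodicIRBound.Negative
  (sqrt_nsq_le_sqrt_three_mul_norm mode_eq)
open Summit.AtomisticToContinuum.BoseEinsteinCondensation.Theorems.ZeroMomentumGround
  (periodicGroundStateEnergy_ne_top_of_lintegral_ne_top)
open Summit.AtomisticToContinuum.BoseEinsteinCondensation.Theorems.CorrectorClosure.HealingScaleKacInsertion
  (periodicGroundStateEnergy_succ_le_add_born)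

namespace KLSTransferProof

/-! ### Real arithmetic -/

/-- `‖(c·k)‖² ≤ 3c²‖k‖_∞²` for the dual-lattice vector of an integer vector (`|k|₂ ≤ √3‖k‖_∞`). [folklore] -/
theorem norm_latticeVec_sq_le {c : ℝ} (hc : 0 ≤ c) (k : Fin 3 → ℤ) :
    ‖latticeVec c k‖ ^ 2 ≤ 3 * c ^ 2 * ‖(fun j => (k j : ℝ))‖ ^ 2 := by
  rw [TransferArith.norm_latticeVec_eq, abs_of_nonneg hc]
  have h := sqrt_nsq_le_sqrt_three_mul_norm k
  have h0 : 0 ≤ Real.sqrt (nsq k) := Real.sqrt_nonneg _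
  have h3 : Real.sqrt 3 ^ 2 = 3 := Real.sq_sqrt (by norm_num)
  calc (c * Real.sqrt (nsq k)) ^ 2 = c ^ 2 * Real.sqrt (nsq k) ^ 2 := by ring
    _ ≤ c ^ 2 * (Real.sqrt 3 * ‖(fun j => (k j : ℝ))‖) ^ 2 := by
        gcongr
    _ = 3 * c ^ 2 * ‖(fun j => (k j : ℝ))‖ ^ 2 := by rw [mul_pow, h3]; ring

/-- **The Born endgame (real arithmetic).** From the KLS moment inequality at `b = CL²/‖n‖²`, `η = min(1, ‖n‖²/(CL²))`,
with `|2πn/L|² ≤ 12π²‖n‖²/L²`, `2N‖v‖₁/L³ ≤ 2ρ‖v‖₁`, monotonicity `e₀ ≤ e₃` and the Born bound `e₀ ≤ e₁ + ρ‖v‖₁`, deduce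
`n_k ≤ C'(1 + √ρL/‖n‖ + ρL²/‖n‖²)` with `C' = 2 + √(12π²C+1) + √(2C‖v‖₁) + C‖v‖₁`. [folklore] -/
theorem born_endgame {nk b η C L nn ρ V εn D3 e0 e1 e3 : ℝ}
    (hC : 0 < C) (hL : 0 < L) (hnn : 1 ≤ nn) (hρ : 0 ≤ ρ) (hV : 0 ≤ V) (hnk : 0 ≤ nk)
    (hb : b = C * L ^ 2 / nn ^ 2) (hη : η = min 1 (nn ^ 2 / (C * L ^ 2)))
    (hε : εn ≤ 12 * Real.pi ^ 2 * nn ^ 2 / L ^ 2) (hD30 : 0 ≤ D3) (hD3 : D3 ≤ 2 * ρ * V)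
    (h03 : e0 ≤ e3) (h01 : e0 ≤ e1 + ρ * V)
    (h : (2 * nk + 1) ^ 2 ≤
      2 * b * ((1 + η) * (εn + D3 + (e0 * (2 * nk + 1) - e1 * nk - e3 * (nk + 1))) + η * (2 * nk + 2))) :
    nk ≤ (2 + Real.sqrt (12 * Real.pi ^ 2 * C + 1) + Real.sqrt (2 * C * V) + C * V) *
      (1 + Real.sqrt ρ * L / nn + ρ * L ^ 2 / nn ^ 2) := by
  have hnn0 : 0 < nn := one_pos.trans_le hnn
  have hb0 : 0 < b := by rw [hb]; positivity
  have hη0 : 0 < η := by rw [hη]; exact lt_min one_pos (by positivity)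
  have hη1 : η ≤ 1 := by rw [hη]; exact min_le_left _ _
  have hbη : b * η ≤ 1 := by
    calc b * η ≤ b * (nn ^ 2 / (C * L ^ 2)) := mul_le_mul_of_nonneg_left (by rw [hη]; exact min_le_right _ _) hb0.le
      _ = 1 := by rw [hb]; field_simp
  set y : ℝ := 2 * nk + 1 with hy
  set e : ℝ := ρ * V with he
  have he0 : 0 ≤ e := by positivity
  set Dm : ℝ := 12 * Real.pi ^ 2 * nn ^ 2 / L ^ 2 + 2 * ρ * V with hDm
  have hDm0 : 0 ≤ Dm := by positivity
  -- the `E₀`-combination is at most `n_k ρ‖v‖₁ ≤ e·(y/2)`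
  have hcomb : e0 * (2 * nk + 1) - e1 * nk - e3 * (nk + 1) ≤ e * (y / 2) := by
    have h2 : 2 * e0 - e1 - e3 ≤ e := by linarith
    have h3 : nk * (2 * e0 - e1 - e3) ≤ nk * e := mul_le_mul_of_nonneg_left h2 hnk
    have h4 : nk ≤ y / 2 := by rw [hy]; linarith
    have h5 : nk * e ≤ y / 2 * e := mul_le_mul_of_nonneg_right h4 he0
    have h6 : e0 * (2 * nk + 1) - e1 * nk - e3 * (nk + 1) = nk * (2 * e0 - e1 - e3) + (e0 - e3) := by ring
    rw [h6]
    linarith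
  have hinner : εn + D3 + (e0 * (2 * nk + 1) - e1 * nk - e3 * (nk + 1)) ≤ Dm + e * (y / 2) := by
    rw [hDm]; linarith
  have h' : y ^ 2 ≤ 2 * b * ((1 + η) * (Dm + e * (y / 2)) + η * (y + 1)) := by
    refine h.trans ?_
    have h1 : (1 + η) * (εn + D3 + (e0 * (2 * nk + 1) - e1 * nk - e3 * (nk + 1))) ≤ (1 + η) * (Dm + e * (y / 2)) :=
      mul_le_mul_of_nonneg_left hinner (by linarith)
    have h2 := mul_le_mul_of_nonneg_left (add_le_add_right h1 (η * (y + 1))) (by positivity : (0 : ℝ) ≤ 2 * b)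
    rw [hy] at h2 ⊢
    linarith
  have hyn : 0 ≤ y := by rw [hy]; linarith
  have hend := kls_endgame hyn hb0.le hη0.le hDm0 he0 h'
  -- bound the convexity-type term
  have hT1 : 2 * b * (1 + η) * (e / 2 + η) ≤ C * V * (ρ * L ^ 2 / nn ^ 2) * 2 + 4 := by
    have hbe : b * e = C * V * (ρ * L ^ 2 / nn ^ 2) := by rw [hb, he]; field_simp
    have h1 : b * e * η ≤ b * e := mul_le_of_le_one_right (mul_nonneg hb0.le he0) hη1
    have h2 : b * η * η ≤ 1 := by
      calc b * η * η ≤ 1 * 1 := mul_le_mul hbη hη1 hη0.le zero_le_one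
        _ = 1 := one_mul 1
    have h3 : 2 * b * (1 + η) * (e / 2 + η) = b * e + b * e * η + 2 * (b * η) + 2 * (b * η * η) := by ring
    rw [h3, ← hbe]
    linarith
  -- bound the `1/‖k‖`-law term
  have hT2in : 2 * b * (1 + η) * (Dm + η) ≤ 4 * (b * Dm + 1) := by
    have h1 : b * Dm * η ≤ b * Dm := mul_le_of_le_one_right (mul_nonneg hb0.le hDm0) hη1
    have h2 : b * η * η ≤ 1 := by
      calc b * η * η ≤ 1 * 1 := mul_le_mul hbη hη1 hη0.le zero_le_one
        _ = 1 := one_mul 1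
    have h3 : 2 * b * (1 + η) * (Dm + η) = 2 * (b * Dm) + 2 * (b * Dm * η) + 2 * (b * η) + 2 * (b * η * η) := by
      ring
    rw [h3]
    linarith
  have hbDm : b * Dm = 12 * Real.pi ^ 2 * C + 2 * C * V * (ρ * L ^ 2 / nn ^ 2) := by
    rw [hb, hDm]; field_simp
  have h4 : Real.sqrt 4 = 2 := by
    rw [show (4 : ℝ) = 2 ^ 2 by norm_num, Real.sqrt_sq (by norm_num)]
  have hsq2 : Real.sqrt (2 * C * V * (ρ * L ^ 2 / nn ^ 2)) = Real.sqrt (2 * C * V) * (Real.sqrt ρ * L / nn) := by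
    rw [Real.sqrt_mul (by positivity), Real.sqrt_div (by positivity), Real.sqrt_mul hρ, Real.sqrt_sq hL.le,
      Real.sqrt_sq hnn0.le]
  have hT2 : Real.sqrt (2 * b * (1 + η) * (Dm + η)) ≤
      2 * (Real.sqrt (12 * Real.pi ^ 2 * C + 1) + Real.sqrt (2 * C * V) * (Real.sqrt ρ * L / nn)) := by
    calc Real.sqrt (2 * b * (1 + η) * (Dm + η)) ≤ Real.sqrt (4 * (b * Dm + 1)) := Real.sqrt_le_sqrt hT2in
      _ = 2 * Real.sqrt (12 * Real.pi ^ 2 * C + 1 + 2 * C * V * (ρ * L ^ 2 / nn ^ 2)) := by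
          rw [Real.sqrt_mul (by norm_num), h4, hbDm]; ring_nf
      _ ≤ 2 * (Real.sqrt (12 * Real.pi ^ 2 * C + 1) + Real.sqrt (2 * C * V * (ρ * L ^ 2 / nn ^ 2))) := by
          gcongr
          -- `√(x + y) ≤ √x + √y`
          rw [Real.sqrt_le_left (by positivity)]
          nlinarith [Real.sq_sqrt (by positivity : (0 : ℝ) ≤ 12 * Real.pi ^ 2 * C + 1),
            Real.sq_sqrt (by positivity : (0 : ℝ) ≤ 2 * C * V * (ρ * L ^ 2 / nn ^ 2)),
            Real.sqrt_nonneg (12 * Real.pi ^ 2 * C + 1), Real.sqrt_nonneg (2 * C * V * (ρ * L ^ 2 / nn ^ 2))]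
      _ = _ := by rw [hsq2]
  -- assemble
  have hX : 0 ≤ Real.sqrt ρ * L / nn := by positivity
  have hY : 0 ≤ ρ * L ^ 2 / nn ^ 2 := by positivity
  have hS1 : 0 ≤ Real.sqrt (12 * Real.pi ^ 2 * C + 1) := Real.sqrt_nonneg _
  have hS2 : 0 ≤ Real.sqrt (2 * C * V) := Real.sqrt_nonneg _
  have hCV : 0 ≤ C * V := by positivity
  have hnk_y : nk = (y - 1) / 2 := by rw [hy]; ring
  rw [hnk_y]
  have hyle : y ≤ C * V * (ρ * L ^ 2 / nn ^ 2) * 2 + 4 +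
      2 * (Real.sqrt (12 * Real.pi ^ 2 * C + 1) + Real.sqrt (2 * C * V) * (Real.sqrt ρ * L / nn)) := by
    linarith
  set S1 := Real.sqrt (12 * Real.pi ^ 2 * C + 1) with hS1def
  set S2 := Real.sqrt (2 * C * V) with hS2def
  set X := Real.sqrt ρ * L / nn with hXdef
  set Y := ρ * L ^ 2 / nn ^ 2 with hYdef
  have hexp : (2 + S1 + S2 + C * V) * (1 + X + Y) =
      (2 + S1 + S2 + C * V) + (2 * X + S1 * X + S2 * X + C * V * X) + (2 * Y + S1 * Y + S2 * Y + C * V * Y) := by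
    ring
  rw [hexp]
  have hyle' : y ≤ C * V * Y * 2 + 4 + 2 * (S1 + S2 * X) := hyle
  linarith [mul_nonneg hS1 hX, mul_nonneg hS1 hY, mul_nonneg hS2 hY, mul_nonneg hCV hX, mul_nonneg hS2 hX,
    mul_nonneg hCV hY]

/-! ### The Born bound on the chemical potential, in reals -/

/-- **Born bound, real form**: `E₀(m+2) ≤ E₀(m+1) + (m+1)‖v‖₁/L³` for an integrable measurable `v` on a torus of side `L > 0`
(`periodicGroundStateEnergy_succ_le_add_born` with `∫_{cell} v^per = ‖v‖₁`). [folklore] -/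
theorem born_le {v : ℝ → ℝ≥0∞} (hv : Measurable v) (hint : (∫⁻ x : Space, v ‖x‖) ≠ ⊤) {m : ℕ} {L : ℝ}
    (hL : 0 < L) (h1 : periodicGroundStateEnergy v (m + 1) L ≠ ⊤) :
    (periodicGroundStateEnergy v (m + 2) L).toReal ≤
      (periodicGroundStateEnergy v (m + 1) L).toReal + ((m : ℝ) + 1) * (∫⁻ x : Space, v ‖x‖).toReal / L ^ 3 := by
  have h := periodicGroundStateEnergy_succ_le_add_born v hv (m + 1) L hL
  have hcell : ∫⁻ x in cell L, periodizedPotential v L x = ∫⁻ x : Space, v ‖x‖ := by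
    have := lintegral_cell_periodizedPotential_sub hL hv (0 : Space)
    simpa only [sub_zero] using this
  rw [hcell] at h
  have hL3 : ENNReal.ofReal (L ^ 3) ≠ 0 := (ENNReal.ofReal_pos.2 (by positivity)).ne'
  have htop : ((m + 1 : ℕ) : ℝ≥0∞) * (ENNReal.ofReal (L ^ 3))⁻¹ * (∫⁻ x : Space, v ‖x‖) ≠ ⊤ :=
    ENNReal.mul_ne_top (ENNReal.mul_ne_top (ENNReal.natCast_ne_top _) (ENNReal.inv_ne_top.2 hL3)) hint
  have h' := ENNReal.toReal_mono (ENNReal.add_ne_top.2 ⟨h1, htop⟩) h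
  rw [ENNReal.toReal_add h1 htop, ENNReal.toReal_mul, ENNReal.toReal_mul, ENNReal.toReal_inv,
    ENNReal.toReal_ofReal (by positivity), ENNReal.toReal_natCast] at h'
  push_cast at h'
  calc (periodicGroundStateEnergy v (m + 2) L).toReal
      ≤ (periodicGroundStateEnergy v (m + 1) L).toReal + ((m : ℝ) + 1) * (L ^ 3)⁻¹ * (∫⁻ x : Space, v ‖x‖).toReal := h'
    _ = _ := by rw [div_eq_mul_inv]; ring

/-! ### The transfer -/

/-- **`KLSTransfer` from the two line stubs** (Kato step S3 and the KLS near-minimiser inequality S4): for an integrable admissible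
`v` with two-sector Gaussian domination `GDFor v K ρ₀ C`, the periodic infrared bound with the KLS shape
`n_Ψ(n) ≤ C'(1 + √ρL_N/‖n‖ + ρL_N²/‖n‖²)`, `C' = 2 + √(12π²C+1) + √(2C‖v‖₁) + C‖v‖₁`, for `ρ < ρ₀/2`, eventually in `N`, with the
least KLS slack over the finite momentum box `‖n‖ ≤ KL_N/(2π)`. [folklore] -/
theorem klsTransfer_of (h3 : KatoSusceptibility) (h4 : KLSNearMinimiser) : KLSTransfer := by
  intro v hv hint hGD
  obtain ⟨K, hK, ρ₀, hρ₀, C, hC, hGD⟩ := hGD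
  have hTC : TwoChannelSusceptibility v K ρ₀ C := h3 v hv hint K ρ₀ C hC hGD
  have hKLS : KLSMomentFor v := h4 v hv hint
  obtain ⟨N₀, hN₀⟩ := eventually_atTop.1 hTC
  set V₁ : ℝ := (∫⁻ x : Space, v ‖x‖).toReal with hV₁def
  have hV₁ : 0 ≤ V₁ := ENNReal.toReal_nonneg
  refine ⟨K, hK, ρ₀ / 2, by positivity,
    2 + Real.sqrt (12 * Real.pi ^ 2 * C + 1) + Real.sqrt (2 * C * V₁) + C * V₁, by positivity,
    fun ρ hρ hρlt => ?_⟩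
  set C' : ℝ := 2 + Real.sqrt (12 * Real.pi ^ 2 * C + 1) + Real.sqrt (2 * C * V₁) + C * V₁ with hC'
  filter_upwards [eventually_ge_atTop (N₀ + 2)] with N hNN₀
  obtain ⟨m, rfl⟩ : ∃ m, N = m + 2 := ⟨N - 2, by omega⟩
  -- notation and side conditions along `L = L_N(ρ)`, `L³ = N/ρ`
  have hL : 0 < sideLength ρ (m + 2) := sideLength_pos_of_pos hρ (by omega)
  have hL3 : sideLength ρ (m + 2) ^ 3 = ((m + 2 : ℕ) : ℝ) / ρ := sideLength_pow_three hρ (m + 2)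
  set L := sideLength ρ (m + 2) with hLdef
  have hfin : ∀ M : ℕ, periodicGroundStateEnergy v M L ≠ ⊤ := fun M =>
    periodicGroundStateEnergy_ne_top_of_lintegral_ne_top hv.1 hint M hL
  have hbig : (m : ℝ) + 3 ≤ ρ₀ * L ^ 3 := by
    rw [hL3, mul_div_assoc', le_div_iff₀ hρ]
    push_cast
    nlinarith [mul_le_mul_of_nonneg_left hρlt.le (by positivity : (0 : ℝ) ≤ (m : ℝ) + 3),
      mul_nonneg hρ₀.le (m.cast_nonneg (α := ℝ))]
  have hsideN : ((m + 2 : ℕ) : ℝ) + 1 ≤ ρ₀ * L ^ 3 := by push_cast; linarith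
  have hsideN' : ((m + 1 : ℕ) : ℝ) + 1 ≤ ρ₀ * L ^ 3 := by push_cast; linarith
  have hne : ((m + 2 : ℕ) : ℝ) ≠ 0 := by positivity
  have hdens : ((m + 2 : ℕ) : ℝ) / L ^ 3 = ρ := by
    rw [hL3, div_div_eq_mul_div, mul_div_cancel_left₀ _ hne]
  -- the two-channel bound at `N = m + 2` and at `N - 1 = m + 1`; monotonicity; the Born bound
  have hTCN := hN₀ (m + 2) (by omega) L hL hsideN (hfin _) (hfin _)
  have hTCN' := hN₀ (m + 1) (by omega) L hL hsideN' (hfin _) (hfin _)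
  have hmono : (periodicGroundStateEnergy v (m + 2) L).toReal ≤ (periodicGroundStateEnergy v (m + 3) L).toReal :=
    ENNReal.toReal_mono (hfin _) (periodicGroundStateEnergy_le_succ hL hv.1 (m + 2))
  have hborn : (periodicGroundStateEnergy v (m + 2) L).toReal ≤
      (periodicGroundStateEnergy v (m + 1) L).toReal + ρ * V₁ := by
    have h := born_le hv.1 hint hL (hfin (m + 1))
    have hm : ((m : ℝ) + 1) * V₁ / L ^ 3 ≤ ρ * V₁ := by
      have h1 : ((m : ℝ) + 1) / L ^ 3 ≤ ρ := by
        rw [div_le_iff₀ (by positivity)]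
        have : ρ * L ^ 3 = (m : ℝ) + 2 := by
          rw [← hdens]; push_cast; field_simp
        linarith
      calc ((m : ℝ) + 1) * V₁ / L ^ 3 = ((m : ℝ) + 1) / L ^ 3 * V₁ := by ring
        _ ≤ ρ * V₁ := mul_le_mul_of_nonneg_right h1 hV₁
    linarith
  -- a slack for each mode of the momentum box
  have hk : ∀ n : Fin 3 → ℤ, ∃ δ : ℝ≥0∞, 0 < δ ∧ ((n ≠ 0 ∧ 2 * Real.pi / L * ‖(fun j => (n j : ℝ))‖ ≤ K) →
      ∀ Ψ : PeriodicTrialState (m + 2) L, NearMinAt v δ Ψ →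
        cellOccupation (m + 2) L (planeWaveMode L n) Ψ.ψ ≤
          ENNReal.ofReal (C' * (1 + Real.sqrt ρ * L / ‖(fun j => (n j : ℝ))‖ +
            ρ * L ^ 2 / ‖(fun j => (n j : ℝ))‖ ^ 2))) := by
    intro n
    by_cases hnw : n ≠ 0 ∧ 2 * Real.pi / L * ‖(fun j => (n j : ℝ))‖ ≤ K
    · have hn1 : 1 ≤ ‖(fun j => (n j : ℝ))‖ := one_le_norm_intVec hnw.1
      set nn : ℝ := ‖(fun j => (n j : ℝ))‖ with hnn
      have hc : 0 < 2 * Real.pi / L := by positivity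
      have hb : 0 ≤ C * L ^ 2 / nn ^ 2 := by positivity
      obtain ⟨hSP, -⟩ := hTCN n hnw.1 hnw.2
      obtain ⟨-, hSM⟩ := hTCN' n hnw.1 hnw.2
      have hη : 0 < min 1 (nn ^ 2 / (C * L ^ 2)) := lt_min one_pos (by positivity)
      obtain ⟨δ, hδ, hδspec⟩ := hKLS m L hL (hfin _) (hfin _) (hfin _) n hnw.1 _ hb hSP hSM _ hη
      refine ⟨δ, hδ, fun _ Ψ hΨ => ?_⟩
      have hocc : cellOccupation (m + 2) L (planeWaveMode L n) Ψ.ψ ≠ ⊤ :=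
        ne_top_of_le_ne_top (ENNReal.natCast_ne_top _) (Ψ.cellOccupation_planeWaveMode_le hL n)
      have hε : ‖latticeVec (2 * Real.pi / L) n‖ ^ 2 ≤ 12 * Real.pi ^ 2 * nn ^ 2 / L ^ 2 := by
        calc ‖latticeVec (2 * Real.pi / L) n‖ ^ 2 ≤ 3 * (2 * Real.pi / L) ^ 2 * nn ^ 2 := norm_latticeVec_sq_le hc.le n
          _ = 12 * Real.pi ^ 2 * nn ^ 2 / L ^ 2 := by field_simp; ring
      have hD3 : 2 * ((m : ℝ) + 2) * V₁ / L ^ 3 = 2 * ρ * V₁ := by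
        rw [← hdens]; push_cast; field_simp
      have hkls := hδspec Ψ hΨ
      rw [← hV₁def] at hkls
      have key := born_endgame (e0 := (periodicGroundStateEnergy v (m + 2) L).toReal)
        (e1 := (periodicGroundStateEnergy v (m + 1) L).toReal) (e3 := (periodicGroundStateEnergy v (m + 3) L).toReal)
        hC hL hn1 hρ.le hV₁ ENNReal.toReal_nonneg rfl rfl hε (by positivity) hD3.le hmono hborn (by
          have : ‖latticeVec (2 * Real.pi / L) n‖ ^ 2 + 2 * ((m : ℝ) + 2) * V₁ / L ^ 3 +
              ((periodicGroundStateEnergy v (m + 2) L).toReal *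
                  (2 * (cellOccupation (m + 2) L (planeWaveMode L n) Ψ.ψ).toReal + 1) -
                (periodicGroundStateEnergy v (m + 1) L).toReal * (cellOccupation (m + 2) L (planeWaveMode L n) Ψ.ψ).toReal -
                (periodicGroundStateEnergy v (m + 3) L).toReal *
                  ((cellOccupation (m + 2) L (planeWaveMode L n) Ψ.ψ).toReal + 1)) =
              ‖latticeVec (2 * Real.pi / L) n‖ ^ 2 + 2 * ((m : ℝ) + 2) * V₁ / L ^ 3 +
              (periodicGroundStateEnergy v (m + 2) L).toReal *
                  (2 * (cellOccupation (m + 2) L (planeWaveMode L n) Ψ.ψ).toReal + 1) -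
                (periodicGroundStateEnergy v (m + 1) L).toReal * (cellOccupation (m + 2) L (planeWaveMode L n) Ψ.ψ).toReal -
                (periodicGroundStateEnergy v (m + 3) L).toReal *
                  ((cellOccupation (m + 2) L (planeWaveMode L n) Ψ.ψ).toReal + 1) := by ring
          rw [this]
          exact hkls)
      exact (ENNReal.ofReal_toReal hocc).symm.le.trans (ENNReal.ofReal_le_ofReal key)
    · exact ⟨1, one_pos, fun h => (hnw h).elim⟩
  choose δf hδf hprop using hk
  -- the least slack over the finite box `‖n‖_∞ ≤ R`, `R = ⌈KL/(2π)⌉`, containing every admissible mode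
  set R : ℕ := ⌈K * L / (2 * Real.pi)⌉₊ with hR
  set W : Finset (Fin 3 → ℤ) := Fintype.piFinset fun _ : Fin 3 => Finset.Icc (-(R : ℤ)) (R : ℤ) with hW
  have hW0 : (0 : Fin 3 → ℤ) ∈ W := by
    rw [hW, Fintype.mem_piFinset]
    intro j
    simp
  have hWne : W.Nonempty := ⟨0, hW0⟩
  refine ⟨W.inf' hWne δf, (Finset.lt_inf'_iff hWne).2 fun k _ => hδf k, fun Ψ hΨ n hn hnK => ?_⟩
  have hmem : n ∈ W := by
    rw [hW, Fintype.mem_piFinset]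
    intro j
    rw [Finset.mem_Icc]
    have hnorm : ‖(fun j => (n j : ℝ))‖ ≤ K * L / (2 * Real.pi) := by
      have h1 : ‖(fun j => (n j : ℝ))‖ = 2 * Real.pi / L * ‖(fun j => (n j : ℝ))‖ * (L / (2 * Real.pi)) := by
        field_simp
      calc ‖(fun j => (n j : ℝ))‖ = 2 * Real.pi / L * ‖(fun j => (n j : ℝ))‖ * (L / (2 * Real.pi)) := h1
        _ ≤ K * (L / (2 * Real.pi)) := mul_le_mul_of_nonneg_right hnK (by positivity)
        _ = K * L / (2 * Real.pi) := by ring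
    have h1 : |(n j : ℝ)| ≤ ‖(fun j => (n j : ℝ))‖ := by
      have := norm_le_pi_norm (fun j => (n j : ℝ)) j
      rwa [Real.norm_eq_abs] at this
    have h2 : |(n j : ℝ)| ≤ ((R : ℕ) : ℝ) := (h1.trans hnorm).trans (Nat.le_ceil _)
    have h3 : |n j| ≤ ((R : ℕ) : ℤ) := by exact_mod_cast h2
    exact ⟨(abs_le.1 h3).1, (abs_le.1 h3).2⟩
  rw [mode_eq]
  exact hprop n ⟨hn, hnK⟩ Ψ (hΨ.trans (add_le_add le_rfl (Finset.inf'_le _ hmem)))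

end KLSTransferProof

end Summit.AtomisticToContinuum.BoseEinsteinCondensation.Cruxes.PeriodicIRBound.TwoSectorGdTransfer

namespace Summit.AtomisticToContinuum.BoseEinsteinCondensation.Theorems

open Summit.AtomisticToContinuum.BoseEinsteinCondensation.Cruxes.PeriodicIRBound.TwoSectorGdTransfer

/-- **Support item stmt-AtomisticToContinuum-12622 `BECTwoSectorGD.KLSTransfer`, proved**: the Kennedy–Lieb–Shastry T = 0 transfer
in the continuum — for every integrable admissible pair potential, two-sector Gaussian domination (the body of stmt-12620) implies
the periodic infrared bound with the KLS shape `n_Ψ(n) ≤ C'(1 + √ρL_N/‖n‖ + ρL_N²/‖n‖²)` for near-minimisers along the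
thermodynamic boxes. Composition of the landed stubs S3 (`stub_katoSusceptibility`, the Kato step) and S4 (`stub_klsNearMinimiser`,
the KLS Cauchy–Schwarz at a near-minimiser) of the crux line `two-sector-gd-transfer` of `PeriodicIRBound` with the Born bound
on the chemical potential (`KLSTransferProof.klsTransfer_of`). -/
theorem KLSTransfer_proof : Summit.AtomisticToContinuum.BoseEinsteinCondensation.Theses.BECTwoSectorGD.KLSTransfer :=
  KLSTransferProof.klsTransfer_of stub_katoSusceptibility stub_klsNearMinimiser

end Summit.AtomisticToContinuum.BoseEinsteinCondensation.Theorems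

end
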